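import Literature.Analysis.FluidPDE.NewtonNearDerivatives
import Literature.Analysis.FluidPDE.NewtonLocalPotential
import Literature.Analysis.FluidPDE.LocalPressureFarFieldTools
import HarnessLib

/-!
# Kernel tools for the local pressure oscillation estimate (Robinson–Rodrigo–Sadowski, Lemma 15.12)

Analysis/FluidPDE support file (all results proved, no definitions, no named facts) for the
discharge of the named fact `Literature.Analysis.FluidPDE.RRS2016.lemma15_12`
(`CKNLocalRegularityRRS.lean`; Robinson–Rodrigo–Sadowski 2016, Lemma 15.12, pp. 232–234: the
local pressure estimate `∫_{B_r} |p - (p)_r|^{3/2} ≤ c ∫_{B_{2r}} |u|³ + c r^{9/2} (∫_{2r<|y|<ρ}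
|u|²|y|⁻⁴)^{3/2} + c (r/ρ)^{9/2} ∫_{B_ρ} (|u|³ + |p|^{3/2})`). In the tree's dual treatment of the
pressure equation (the Newtonian kernel is moved onto the test function: for `ψ ∈ C_c^∞(B_r(a))`
the truncated potential `N[ψ] = Γ₀ ⋆ ψ`, `Γ₀ = newtonNear r₀ r₁`, is inserted in
`-Δp = ∂ᵢ∂ⱼ(uᵢuⱼ)`, `CKNPressureDuality.lean`, `CKNPressureEstimate.lean`) the two "far" terms of
the printed proof (p. 233: `p_{1,2}` and `p_{2,·}, p_{3,·}`, bounded through their gradients and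
the mean value theorem) become kernel increments on the test-function side. This file supplies
the three kernel facts used for them:

* `exists_abs_newtonNearHess_sub_le` — **the two-centre bound for the truncated Hessian
  kernel** `∂ᵥ∂ᵥΓ₀` (`newtonNearHess`): `|∂ᵥ∂ᵥΓ₀(y - x) - ∂ᵥ∂ᵥΓ₀(y - x₀)| ≤ C |x - x₀| |v|² / |y - x₀|⁴`
  whenever `2|x - x₀| ≤ |y - x₀|` (mean value theorem for `D²Γ₀` along the segment, which stays at
  distance `≥ |y - x₀|/2` from the origin, with `‖D³Γ₀(z)‖ ≤ C|z|⁻⁴`,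
  `exists_norm_fderiv3_newtonNear_le`; the analogue for the untruncated kernel is
  `exists_abs_pressureKernel_sub_le`, `LocalPressureFarFieldTools.lean`) — this is the kernel
  estimate behind "`|∇p_{1,2}(x)| ≤ c ∫_{|y|>2r} |x-y|⁻⁴ φ|u|²`" (RRS p. 233);
* `fderiv_fderiv_newtonNearPotential_eq_integral_of_far` — **the Hessian of the truncated
  potential off the support**: if `tsupport ψ ⊆ B_r(a)` and `|y - a| ≥ 2r` then
  `D²N[ψ](y)(v, v) = ∫ ψ(x) ∂ᵥ∂ᵥΓ₀(y - x) dx` (on a neighbourhood of `y` the kernel may be replaced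
  by the smooth, compactly supported `(1 - χ)Γ₀`, `χ` a cut-off at the origin, and derivatives pass
  under the integral, `contDiff_two_integral_clm_apply_comp_sub` of `PressureRepresentation.lean`);
* `exists_lipschitzWith_newtonFarLaplacian` — the smoothing kernel `λ = Δ((1-θ)Γ)`
  (`newtonFarLaplacian`, smooth with compact support) is Lipschitz.

## References

* J. C. Robinson, J. L. Rodrigo, W. Sadowski, *The three-dimensional Navier–Stokes equations*,
  CUP (2016), proof of Lemma 15.12, p. 233. [RobinsonRodrigoSadowski2016]
* D. Gilbarg, N. S. Trudinger, *Elliptic partial differential equations of second order* (2001),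
  Lemma 4.1–4.2 with (4.9)–(4.10) (derivatives of Newtonian potentials off the density).
  [GilbargTrudinger2001]
-/

noncomputable section

open MeasureTheory Set Function Filter Topology TopologicalSpace Metric
open scoped ENNReal NNReal RealInnerProductSpace ContDiff

namespace Literature.Analysis.FluidPDE

-- nested operator types `ℝ³ →L[ℝ] ℝ³ →L[ℝ] ℝ³ →L[ℝ] ℝ`
set_option maxSynthPendingDepth 3

variable {r₀ r₁ : ℝ}

/-! ### The two-centre bound for the truncated Hessian kernel -/

/-- **Two-centre (Hörmander) bound for `∂ᵥ∂ᵥΓ₀`.** For the truncated Newtonian kernel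
`Γ₀ = newtonNear r₀ r₁` (`0 < r₀ < r₁`) there is `C ≥ 0` with
`|∂ᵥ∂ᵥΓ₀(y - x) - ∂ᵥ∂ᵥΓ₀(y - x₀)| ≤ C |x - x₀| |v|² / |y - x₀|⁴` whenever `2|x - x₀| ≤ |y - x₀|`,
`y ≠ x₀`: the mean value theorem for `D²Γ₀` on the segment from `y - x₀` to `y - x` (on which
`|·| ≥ |y - x₀|/2`) and `‖D³Γ₀(z)‖ ≤ C₃|z|⁻⁴` (`exists_norm_fderiv3_newtonNear_le`); cf.
`exists_abs_pressureKernel_sub_le` for `Γ` itself. [folklore] -/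
theorem exists_abs_newtonNearHess_sub_le (h₀ : 0 < r₀) (h₁ : r₀ < r₁) :
    ∃ C : ℝ, 0 ≤ C ∧ ∀ x₀ x y v : EuclideanSpace ℝ (Fin 3), 2 * ‖x - x₀‖ ≤ ‖y - x₀‖ → y ≠ x₀ →
      |newtonNearHess r₀ r₁ v v (y - x) - newtonNearHess r₀ r₁ v v (y - x₀)| ≤
        C * ‖x - x₀‖ * ‖v‖ ^ 2 / ‖y - x₀‖ ^ 4 := by
  obtain ⟨M, hM0, hM⟩ := exists_norm_fderiv3_newtonNear_le h₀ h₁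
  refine ⟨16 * M, by positivity, fun x₀ x y v hxy hy => ?_⟩
  set F := fderiv ℝ (fderiv ℝ (newtonNear r₀ r₁)) with hF
  have hd : 0 < ‖y - x₀‖ := norm_pos_iff.2 (sub_ne_zero.2 hy)
  set ρ : ℝ := ‖y - x₀‖ / 2 with hρ
  have hρ0 : 0 < ρ := by positivity
  set z : EuclideanSpace ℝ (Fin 3) := y - x with hz
  set z' : EuclideanSpace ℝ (Fin 3) := y - x₀ with hz'
  have hzz' : z - z' = x₀ - x := by rw [hz, hz']; abel
  have hxx : ‖x₀ - x‖ = ‖x - x₀‖ := norm_sub_rev _ _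
  -- every point of the segment has norm at least `ρ`
  have hseg : ∀ s ∈ segment ℝ z' z, ρ ≤ ‖s‖ := fun s hs => by
    have h1 := norm_sub_norm_le_of_mem_segment hs
    rw [hzz', hxx] at h1
    rw [hρ]
    linarith
  have hne : ∀ s ∈ segment ℝ z' z, s ≠ 0 := fun s hs h0 => by
    have := hseg s hs
    rw [h0, norm_zero] at this
    linarith
  -- differentiability of `D²Γ₀` on the segment and the derivative bound
  have hdiff : ∀ s ∈ segment ℝ z' z, DifferentiableAt ℝ F s := fun s hs =>
    ((contDiffOn_fderiv2_newtonNear r₀ r₁ (n := 1)).differentiableOn one_ne_zero).differentiableAt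
      (isOpen_compl_singleton.mem_nhds (hne s hs))
  have hbound : ∀ s ∈ segment ℝ z' z, ‖fderiv ℝ F s‖ ≤ M / ρ ^ 4 := fun s hs => by
    have hs0 : 0 < ‖s‖ := hρ0.trans_le (hseg s hs)
    have h1 : ‖s‖ ^ (-(4 : ℝ)) ≤ ρ ^ (-(4 : ℝ)) :=
      Real.rpow_le_rpow_of_nonpos hρ0 (hseg s hs) (by norm_num)
    have h2 : ρ ^ (-(4 : ℝ)) = (ρ ^ 4)⁻¹ := by
      rw [Real.rpow_neg hρ0.le, show (4 : ℝ) = ((4 : ℕ) : ℝ) by norm_num, Real.rpow_natCast]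
    calc ‖fderiv ℝ F s‖ ≤ M * ‖s‖ ^ (-(4 : ℝ)) := hM s (hne s hs)
      _ ≤ M * ρ ^ (-(4 : ℝ)) := mul_le_mul_of_nonneg_left h1 hM0
      _ = M / ρ ^ 4 := by rw [h2, div_eq_mul_inv]
  have hMVT := (convex_segment z' z).norm_image_sub_le_of_norm_fderiv_le hdiff hbound
    (left_mem_segment ℝ z' z) (right_mem_segment ℝ z' z)
  rw [newtonNearHess_apply, newtonNearHess_apply, ← hF]
  have e1 : F z v v - F z' v v = (F z - F z') v v := by
    simp only [_root_.sub_apply]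
  rw [e1]
  calc |(F z - F z') v v| ≤ ‖(F z - F z') v‖ * ‖v‖ := by
        rw [← Real.norm_eq_abs]
        exact ((F z - F z') v).le_opNorm v
    _ ≤ ‖F z - F z'‖ * ‖v‖ * ‖v‖ := by
        gcongr
        exact (F z - F z').le_opNorm v
    _ ≤ M / ρ ^ 4 * ‖z - z'‖ * ‖v‖ * ‖v‖ := by gcongr
    _ = 16 * M * ‖x - x₀‖ * ‖v‖ ^ 2 / ‖y - x₀‖ ^ 4 := by
        rw [hzz', hxx, hρ, hz']
        field_simp
        ring

/-! ### The Hessian of the truncated potential off the support of the density -/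

/-- The kernel `(1 - χ_{δ/2, δ}) Γ₀` (the truncated Newtonian kernel with its singularity cut out
at scale `δ > 0`) is smooth on all of `ℝ³`: near the origin it vanishes identically, elsewhere
both factors are smooth. [folklore] -/
theorem contDiff_one_sub_radialCutoff_mul_newtonNear (r₀ r₁ : ℝ) {δ : ℝ} (hδ : 0 < δ)
    {n : ℕ∞} :
    ContDiff ℝ n (fun z : EuclideanSpace ℝ (Fin 3) =>
      (1 - radialCutoff (δ / 2) δ z) * newtonNear r₀ r₁ z) := by
  rw [contDiff_iff_contDiffAt]
  intro z
  by_cases hz : z = 0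
  · have hev : (fun w : EuclideanSpace ℝ (Fin 3) =>
        (1 - radialCutoff (δ / 2) δ w) * newtonNear r₀ r₁ w) =ᶠ[𝓝 z] fun _ => 0 := by
      have hb : ball (0 : EuclideanSpace ℝ (Fin 3)) (δ / 2) ∈ 𝓝 z := by
        rw [hz]; exact ball_mem_nhds _ (by positivity)
      filter_upwards [hb] with w hw
      rw [radialCutoff_eq_one (by positivity) (by linarith) (mem_ball_zero_iff.1 hw).le]
      ring
    exact contDiffAt_const.congr_of_eventuallyEq hev
  · exact ((contDiff_const.sub (radialCutoff_contDiff (δ / 2) δ)).contDiffAt).mul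
      (contDiffAt_newtonNear r₀ r₁ hz)

/-- Off the ball of radius `δ` the cut-out kernel is the truncated Newtonian kernel itself.
[folklore] -/
theorem one_sub_radialCutoff_mul_newtonNear_eq {δ : ℝ} (hδ : 0 < δ) {z : EuclideanSpace ℝ (Fin 3)}
    (hz : δ ≤ ‖z‖) :
    (1 - radialCutoff (δ / 2) δ z) * newtonNear r₀ r₁ z = newtonNear r₀ r₁ z := by
  rw [radialCutoff_eq_zero (by positivity) (by linarith) hz]
  ring

/-- **The Hessian of the truncated Newtonian potential away from the density.** Let
`Γ₀ = newtonNear r₀ r₁` (`0 < r₀ < r₁`), let `ψ` be continuous with compact support,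
`tsupport ψ ⊆ B_r(a)`, `r > 0`, and let `|y - a| ≥ 2r`. Then for every direction `v`
`D²N[ψ](y)(v, v) = ∫ ψ(x) ∂ᵥ∂ᵥΓ₀(y - x) dx` (`N[ψ](y) = ∫ Γ₀(z) ψ(y - z) dz`,
`newtonNearPotential`; `∂ᵥ∂ᵥΓ₀ = newtonNearHess r₀ r₁ v v`). Proof: on `B(y, r/2)` the potential
is `∫ ψ(x) K(y' - x) dx` with the smooth compactly supported `K = (1 - χ_{r/4,r/2})Γ₀`, since
`|y' - x| ≥ r/2` for `x ∈ B_r(a)`; derivatives of the latter fall on `K`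
(`contDiff_two_integral_clm_apply_comp_sub`), and `D²K(y - x) = D²Γ₀(y - x)` for such `x`.
(Gilbarg–Trudinger, Lemma 4.1–4.2: derivatives of the Newtonian potential off the density.)
[cite: GilbargTrudinger2001, Lemma 4.1–4.2 with (4.9)–(4.10)] -/
theorem fderiv_fderiv_newtonNearPotential_eq_integral_of_far (h₀ : 0 < r₀) (h₁ : r₀ < r₁)
    {ψ : EuclideanSpace ℝ (Fin 3) → ℝ} (hψ : Continuous ψ) (hψc : HasCompactSupport ψ)
    {a : EuclideanSpace ℝ (Fin 3)} {r : ℝ} (hr : 0 < r) (hsupp : tsupport ψ ⊆ ball a r)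
    {y : EuclideanSpace ℝ (Fin 3)} (hy : 2 * r ≤ ‖y - a‖) (v : EuclideanSpace ℝ (Fin 3)) :
    fderiv ℝ (fderiv ℝ (newtonNearPotential r₀ r₁ ψ)) y v v =
      ∫ x, ψ x * newtonNearHess r₀ r₁ v v (y - x) := by
  -- the cut-out kernel at scale `δ = r/2`
  set δ : ℝ := r / 2 with hδ
  have hδ0 : 0 < δ := by positivity
  set K : EuclideanSpace ℝ (Fin 3) → ℝ := fun z =>
    (1 - radialCutoff (δ / 2) δ z) * newtonNear r₀ r₁ z with hK
  have hKs : ContDiff ℝ 2 K := contDiff_one_sub_radialCutoff_mul_newtonNear r₀ r₁ hδ0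
  have hKc : HasCompactSupport K := (hasCompactSupport_newtonNear h₀.le h₁).mul_left
  have hKeq : ∀ z : EuclideanSpace ℝ (Fin 3), δ ≤ ‖z‖ → K z = newtonNear r₀ r₁ z :=
    fun z hz => one_sub_radialCutoff_mul_newtonNear_eq hδ0 hz
  -- bounds for `K`, `DK`, `D²K`
  obtain ⟨M₀, hM₀⟩ := hKs.continuous.bounded_above_of_compact_support hKc
  have hK1 : ContDiff ℝ 1 (fderiv ℝ K) := hKs.fderiv_right (m := 1) le_rfl
  obtain ⟨M₁, hM₁⟩ := (hKs.continuous_fderiv two_ne_zero).bounded_above_of_compact_support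
    (hKc.fderiv (𝕜 := ℝ))
  obtain ⟨M₂, hM₂⟩ := (hK1.continuous_fderiv one_ne_zero).bounded_above_of_compact_support
    ((hKc.fderiv (𝕜 := ℝ)).fderiv (𝕜 := ℝ))
  -- the weight `L x = ψ x • id`
  set L : EuclideanSpace ℝ (Fin 3) → ℝ →L[ℝ] ℝ := fun x => ψ x • ContinuousLinearMap.id ℝ ℝ
    with hL
  have hLc : Continuous L := hψ.smul continuous_const
  have hLi : Integrable L := (hψ.integrable_of_hasCompactSupport hψc).smul_const _
  have hLapp : ∀ (x : EuclideanSpace ℝ (Fin 3)) (c : ℝ), L x c = ψ x * c := fun x c => by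
    simp [hL]
  -- points of the support are far from `y` and from `B(y, δ)`
  have hsupp' : ∀ x, ψ x ≠ 0 → x ∈ ball a r := fun x hx => hsupp (subset_tsupport _ hx)
  have hfar : ∀ y' ∈ ball y δ, ∀ x, ψ x ≠ 0 → δ ≤ ‖y' - x‖ := by
    intro y' hy' x hx
    have hxa : ‖x - a‖ < r := mem_ball_iff_norm.1 (hsupp' x hx)
    have hyy : ‖y' - y‖ < δ := mem_ball_iff_norm.1 hy'
    have h1 : ‖y - a‖ ≤ ‖y' - x‖ + ‖y' - y‖ + ‖x - a‖ := by
      calc ‖y - a‖ = ‖(y' - x) - (y' - y) + (x - a)‖ := by congr 1; abel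
        _ ≤ ‖(y' - x) - (y' - y)‖ + ‖x - a‖ := norm_add_le _ _
        _ ≤ ‖y' - x‖ + ‖y' - y‖ + ‖x - a‖ := by gcongr; exact norm_sub_le _ _
    rw [hδ] at hyy ⊢
    linarith
  -- Step A: near `y` the potential is the integral against the smooth kernel
  set N : EuclideanSpace ℝ (Fin 3) → ℝ := fun y' => ∫ x, L x (K (y' - x)) with hN
  have hagree : newtonNearPotential r₀ r₁ ψ =ᶠ[𝓝 y] N := by
    filter_upwards [ball_mem_nhds y hδ0] with y' hy'
    rw [hN, newtonNearPotential_apply]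
    have hsub := integral_sub_left_eq_self
      (fun x => newtonNear r₀ r₁ (y' - x) * ψ x) volume y'
    simp only [sub_sub_cancel] at hsub
    rw [hsub]
    refine integral_congr_ae (Eventually.of_forall fun x => ?_)
    beta_reduce
    rw [hLapp]
    by_cases hx : ψ x = 0
    · simp [hx]
    · rw [hKeq _ (hfar y' hy' x hx), mul_comm]
  -- Step B: second derivatives at `y` agree
  have hD2 : fderiv ℝ (fderiv ℝ (newtonNearPotential r₀ r₁ ψ)) y = fderiv ℝ (fderiv ℝ N) y :=
    (hagree.fderiv (𝕜 := ℝ)).fderiv_eq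
  -- Step C: derivatives under the integral for the smooth kernel
  obtain ⟨hN2, hNf⟩ := contDiff_two_integral_clm_apply_comp_sub (L := L) hKs hM₀ hM₁ hM₂ hLc hLi
  have hswap : fderiv ℝ (fun x' => fderiv ℝ N x' v) y v = fderiv ℝ (fderiv ℝ N) y v v := by
    have hd : DifferentiableAt ℝ (fderiv ℝ N) y :=
      ((hN2.fderiv_right (m := 1) le_rfl).differentiable one_ne_zero) y
    rw [fderiv_clm_apply hd (differentiableAt_const v)]
    simp
  rw [hD2, ← hswap, hNf y v]
  refine integral_congr_ae (Eventually.of_forall fun x => ?_)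
  beta_reduce
  rw [hLapp]
  by_cases hx : ψ x = 0
  · simp [hx]
  · have hyx : δ < ‖y - x‖ := by
      have hxa : ‖x - a‖ < r := mem_ball_iff_norm.1 (hsupp' x hx)
      have h1 : ‖y - a‖ ≤ ‖y - x‖ + ‖x - a‖ := by
        calc ‖y - a‖ = ‖(y - x) + (x - a)‖ := by congr 1; abel
          _ ≤ ‖y - x‖ + ‖x - a‖ := norm_add_le _ _
      rw [hδ]
      linarith
    have hev : K =ᶠ[𝓝 (y - x)] newtonNear r₀ r₁ := by
      have hopen : IsOpen {z : EuclideanSpace ℝ (Fin 3) | δ < ‖z‖} :=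
        isOpen_lt continuous_const continuous_norm
      filter_upwards [hopen.mem_nhds hyx] with z hz using hKeq z (le_of_lt hz)
    rw [newtonNearHess_apply, (hev.fderiv (𝕜 := ℝ)).fderiv_eq]

/-! ### The smoothing kernel is Lipschitz -/

/-- The smoothing kernel `λ = Δ((1 - θ)Γ)` (`newtonFarLaplacian r₀ r₁`, `0 < r₀ < r₁`) is
Lipschitz (it is `C¹` with compact support). [folklore] -/
theorem exists_lipschitzWith_newtonFarLaplacian (h₀ : 0 < r₀) (h₁ : r₀ < r₁) :
    ∃ K : ℝ≥0, LipschitzWith K (newtonFarLaplacian r₀ r₁) :=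
  (contDiff_newtonFarLaplacian h₀ h₁ (n := 1)).lipschitzWith_of_hasCompactSupport
    (hasCompactSupport_newtonFarLaplacian h₀.le h₁) one_ne_zero

end Literature.Analysis.FluidPDE

end
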